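import Summits.BirchSwinnertonDyer.Rank1Residual.Additive.O7RankOneStatements
import Summits.BirchSwinnertonDyer.Rank1Residual.Additive.PotSupersingularTargets
import HarnessLib
import HarnessLib.Audit.Tags

/-!
# Class O7 (X3 ∪ X4, analytic rank ONE, odd additive prime) = O7-ord ⊔ O7-ss, as a KERNEL PARTITION
# over the tree's cell predicates; the O7-ss cells in Miller's currency; the `(G) ∧ ss` cell and its
# sub-partition (cell `b2b-bsdres`, lane CLASS-CLOSURE, seat cc-typer-2 = the O7 typer; team n1011,
# r = 1 strand; companion of `Additive/O7RankOneStatements.lean` (O7-ord) and of cc-typer-5's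
# `Additive/PotSupersingular{Classes,Targets}.lean` (classes O5 / O6, ranks `≤ 1`))

HONEST FRAMING (cell `b2b-bsdres`, run/shared/lean/b2b/bsd-rank1-residual/, verbatim in every
file): the goal of the cell is to DELETE the COMBINATION-SHAPED residual classes of the
Birch–Swinnerton-Dyer formula for ALL analytic-rank `≤ 1` elliptic curves over `ℚ` — "full BSD
formula for every rank `≤ 1` curve in class `C`" assembled STRICTLY from published theorems — so
that the rank-`≤ 1` remainder becomes exactly the CONSTRUCTION-SHAPED classes, which are TYPED
(missing-input `Prop`s), NOT attempted. This is not "finishing BSD". Lane CLASS-CLOSURE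
(coordinator ruling 2026-08-21T04:07:19Z): research routes; no claim beyond the stated classes;
census / instrument output is EVIDENCE, never a Literature fact; per-pair certificates are
instrumentation; O7 stays OPEN as a MARK (RESIDUAL-MAP §I O7-ord ∣ O7-ss); NOTHING is booked and no
label moves. This file contains `@[conjecture]` statements (nothing asserted), two cell predicates
with bodies, and propositional bookkeeping theorems proved from tree theorems only; no named fact
(net debt `0`).

## Why this file (the human's question "are we sure the classes fully partition the space?" at
## the level of ONE open class)

RESIDUAL-MAP §I records class O7 as "X3 ∪ X4, `r = 1`" at an odd additive prime, split by the
potential reduction type into **O7-ord** ((M) ∪ (G-ord): typed in `O7RankOneStatements.lean` as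
`O7.PPart` over `N10.Locus W p`) and **O7-ss** (potentially SUPERSINGULAR: `(G) ∧ ss` ∪ (t′) ∪ (w),
"nothing formulated"). The O7-ss cells are exactly the rank-one rows of cc-typer-5's classes O5
(`ClassO5 = (G) ∧ ss ∪ (t′)`, tame) and O6 (`ClassO6 = (w)`, wild, `p = 3`), typed for ranks `≤ 1`
in `PotSupersingularTargets.lean` (`O5Sharp`, `O5SharpGss`, `O5SharpTprime`, `O6Sharp`). This file
records, as kernel theorems over those EXISTING predicates (nothing re-declared):

* §1 `O7.SS W p := ClassO5 W p ∨ ClassO6 W p` (the O7-ss locus), the two tame cells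
  `O7.CellGss := p ≠ 2 ∧ Addv ∧ SubGss` and `O7.CellTprime := p ≠ 2 ∧ Addv ∧ SubTprime` (the wild cell
  IS `ClassO6`), and **the partition of the whole class**: every odd additive pair is in
  `N10.Locus` (O7-ord) or in `O7.SS` (O7-ss) (`O7.locus_or_ss`, from cc-typer-5's `addv_odd_cells`
  and `subGord_of_typeGOrd_of_addv`), never in both (`O7.not_ss_of_locus`), i.e.
  `p ≠ 2 ∧ Addv W p ↔ N10.Locus W p ∨ O7.SS W p` (`O7.pair_iff_locus_or_ss`); `O7.SS ↔` its three
  cells (`O7.ss_iff_cells`), pairwise disjoint (`O7.ss_cells_disjoint`).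
* §2 the Miller-currency statements `O7.PPartAll` (all of O7), `O7.PPartSS` (O7-ss) and its cells
  `O7.PPartGss / PPartTprime / PPartW`, with `O7.pPartAll_iff : PPartAll ↔ O7.PPart ∧ O7.PPartSS`,
  `O7.pPartSS_iff : PPartSS ↔ PPartGss ∧ PPartTprime ∧ PPartW` — NO PAIR LOST, NONE COUNTED TWICE —
  and the comparison with the owners' objects: `O7.PPartSS` IS the rank-one restriction of
  `O5Sharp ∧ O6Sharp` (`O7.pPartSS_of_o5Sharp_of_o6Sharp`; cell by cell), `O7.PPartAll` that of
  `X3Sharp ∧ X4Sharp` (`O7.pPartAll_of_x3Sharp_of_x4Sharp`). ONE STATEMENT, ONE OWNER: the O7-ss class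
  TARGETS are cc-typer-5's `O5Sharp*` / `O6Sharp`; the `O7.PPart*` cells here are their `r = 1`
  restrictions, kept so that the O7 census cells (`class-closure/O7/pairs.tsv`) line up 1 : 1 with
  kernel predicates.
* §3 the cell `(G) ∧ ss` of O7-ss (`O7.CellGss`): it lies in X4 (`E[p]` irreducible —
  `not_subGss_of_classX3`), is Kodaira `I₀*` (`SubGss.subGordTwo`: `E = V ⊗ χ_{p*}` with `V` GOOD
  SUPERSINGULAR at `p`), hence inside `SubSemistableTwist` but outside `N10.Locus`; its first
  formulated sub-class and the sub-partition are recorded in the docstring of `O7.PPartGss` (below).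

## The `(G) ∧ ss` cell of O7-ss: SUB-PARTITION and the verbatim-extension sub-class (deliverable (b))

Census of record (EVIDENCE, cc-eng-1 `obsanat` 0.2.7: `class-closure/O7/pairs.tsv` sha16
`27107d0f55816358`, 31 429 cells = cells of record, all `r = 1`; typed sub-partition
`O7/E2-hypotheses.tsv.gz` sha16 `494e6e893b6df645`; this seat's T4 join 2026-08-21): O7 = O7-ord
11 485 (`SubM` 7 801 · (G-ord) 3 684) ⊔ O7-ss 19 944 (`SubGss` **515** · `SubTprime` 4 705 ·
`SubW` 14 724). NOTE for consumers of the `obsanat` atom `red = add(f=2,G-ss)` (5 220 cells): it is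
the TAME potentially supersingular locus `SubTameSS = SubGss ∨ SubTprime` (cc-typer-5), NOT the tree's
`SubGss`; the finer witness token `Gss2` / typed token `Additive.SubGss` is the `e = 2` cell. The 515
`SubGss` cells: all X4, all NON-CM, all `E(ℚ_p)[p] = 0`; `p = 3`: 485, `p = 5`: 29, `p = 7`: 1;
image `ρ̄_{E,p}` surjective on 408 (387 @3, all with the tower bit `SURJ9`; 20 @5; 1 @7) and
normaliser-of-non-split-Cartan on 107 (98 @3, 9 @5 — these are also O8 rows); `ord_p #Ш_an = 0` on
506, `= 2` on 9 (@3, surjective); the good supersingular twist `V` is CLOSED at `p` of record on 471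
(its own cell: JSW 2017 row C3 / X6-type records), not on 44 (29 with `r_an(V) = 2`, 15 residue).

(E2) **Verbatim-extension sub-class** = `O7.CellGss ∧ r_an = 1 ∧ ρ_{V,p^∞} onto` (408 cells by the
census bits: Serre at `p ≥ 5`, `SURJ9` at `p = 3`): there Kobayashi, Invent. Math. 152 (2003) Thm. 4.1
with `n = 0` on the ODD `η = ω^{(p−1)/2}`-branch of `V` + Lemma 9.1 + Kitajima–Otsuki 2018 Main Thm. 1.3
(sign `−`) + Greenberg LNM 1716 Lemma 4.2 assemble — every ingredient PRINTED, the assembly unwritten —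
into the UPPER bound `ord_p #Sel_str(E/ℚ)[p^∞] ≤ v_p((X⁻¹L_p⁻(V, η, X))(0))`, typed by cc-typer-6 as
the input `QuadraticBranchOddStrictSelmerBoundAt W p` (p259634,
`Additive/QuadraticBranchOddStrictSelmer.lean`; prover targets (P1)–(P3) in its module docstring),
plus the elementary `StrictSelmerDominatesShaAt W p` ((P4); x1b GEN 26's plan
`HOME/b2b-bsdres-x1b/gen26/P4-PLAN-StrictSelmerDominatesSha.md`); with the two per-pair certificates
(i) `coeff₁ L_p⁻(V, η, X) ∈ ℤ_p^×`, (ii) `ord_p #Ш_an(E) = 0` her sibling consumer gives `BSD(E, p)`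
with NO `p`-adic height (the statement for provers is exactly those two typed inputs). (E2) **Residue
inside the cell** = the 107 non-surjective twins (Thm. 4.1's `pⁿ` not effective; conditional form
`QuadraticBranchOddStrictSelmerBoundOfPlusMCAt` on Kobayashi's EVEN main conjecture for `V` at `η`,
CONJECTURE in print) ∪ the rows where (i) or (ii) fails (there the EXACT odd main conjecture
`Char X^{−,η} = (X⁻¹L_p⁻)` and a leading-term formula on the `η`-branch would be needed — nothing in
print: FORMULATE). (E3) **Transport of record for the cell** = quadratic base change to
`K = ℚ(√p*)`: cc-typer-5's `SubGss.bsdp_iff_overC_of_bsdp_twist` / `…missingLowerBoundAt_iff_overC…`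
(Milne 1972 §1 Thm. 1; granted `BSD_p(V)`, `BSD_p(E) ⟺` the `p`-part of BSD for `E_K` over `K`, `p`
RAMIFIED in `K`). Nothing here is a theorem about a curve's `Ш` without a conjecture as hypothesis.

References: RESIDUAL-MAP.md §I O7/O5/O6; CLASS-CLOSURE-PLAN.md §3.3–§3.5; `class-closure/O7/STATEMENT.md`;
[Kobayashi2003] §2, Thm. 4.1, Lemma 9.1; [KitajimaOtsuki2018] Main Thm. 1.3; [Milne1972ArithmeticAV] §1 Thm. 1;
[Delbourgo1998] p. 152; [Miller2011LMS] Def. 1.1.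
-/

noncomputable section

open scoped Classical

open WeierstrassCurve Literature.NumberTheory.EllipticCurves
  Literature.NumberTheory.EllipticCurves.ModularForms
  Literature.NumberTheory.EllipticCurves.Rank1Residual
  Literature.NumberTheory.EllipticCurves.Rank1Residual.Typed

namespace Summit.BirchSwinnertonDyer.Rank1Residual.Additive

/-! ## §1 The O7-ss locus, its cells, and the partition O7 = O7-ord ⊔ O7-ss -/

section Cells

variable (W : WeierstrassCurve ℚ) [W.IsElliptic] [W.IsGloballyMinimal] (p : ℕ) [hp : Fact p.Prime]

/-- **The O7-ss locus** (rank-free): an ODD additive prime of potentially SUPERSINGULAR type — tame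
(`ClassO5 = (G) ∧ ss ∪ (t′)`) or wild (`ClassO6 = (w)`, then `p = 3`). RESIDUAL-MAP §I O7-ss =
these pairs in analytic rank one (S-b 19 949; `class-closure/O7/pairs.tsv` 19 944 cells). A locus
predicate over cc-typer-5's class predicates; nothing asserted. [folklore] -/
def O7.SS : Prop := ClassO5 W p ∨ ClassO6 W p

/-- **Cell `(G) ∧ ss` of O7-ss / O5**: `p ≠ 2 ∧ Addv W p ∧ SubGss W p` — Delbourgo's (G) holds but the
potential good reduction is supersingular; then `e = 2` (Kodaira `I₀*`) and `E = V ⊗ χ_{p*}` with `V`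
good supersingular at `p` (`O7.CellGss.subGordTwo`). Census: 515 O7 cells (485 @3, 29 @5, 1 @7), all
X4, all non-CM. [folklore] -/
def O7.CellGss : Prop := p ≠ 2 ∧ Addv W p ∧ SubGss W p

/-- **Cell (t′) of O7-ss / O5**: `p ≠ 2 ∧ Addv W p ∧ SubTprime W p` — tame, potentially good,
`e ∈ {3,4,6}` with `e ∤ p − 1` (at `p = 3`: `e = 4`, Kodaira III/III*); no quadratic twist / abelian
base change reaches a semistable situation (the irreducible residue of O5, cc-typer-5). Census: 4 705
O7 cells (X3 3 112 + X4 1 593). The wild cell of O7-ss is `ClassO6 W p` itself (14 724 cells).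
[folklore] -/
def O7.CellTprime : Prop := p ≠ 2 ∧ Addv W p ∧ SubTprime W p

/-- `O7.SS` is the union of its three cells `(G) ∧ ss`, (t′), (w). [folklore] -/
theorem O7.ss_iff_cells : O7.SS W p ↔ O7.CellGss W p ∨ O7.CellTprime W p ∨ ClassO6 W p := by
  constructor
  · rintro (⟨hp2, hadd, hG | hT⟩ | h6)
    · exact Or.inl ⟨hp2, hadd, hG⟩
    · exact Or.inr (Or.inl ⟨hp2, hadd, hT⟩)
    · exact Or.inr (Or.inr h6)
  · rintro (⟨hp2, hadd, hG⟩ | ⟨hp2, hadd, hT⟩ | h6)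
    · exact Or.inl ⟨hp2, hadd, Or.inl hG⟩
    · exact Or.inl ⟨hp2, hadd, Or.inr hT⟩
    · exact Or.inr h6

/-- The three O7-ss cells are pairwise disjoint (cc-typer-5's `subGss_disjoint`,
`subGord_subTprime_subW_disjoint`, `ClassO5.not_classO6`). [folklore] -/
theorem O7.ss_cells_disjoint :
    (O7.CellGss W p → ¬ O7.CellTprime W p ∧ ¬ ClassO6 W p) ∧ (O7.CellTprime W p → ¬ ClassO6 W p) := by
  refine ⟨fun hG ↦ ⟨fun hT ↦ ((subGss_disjoint W p).1 hG.2.2).2.2.1 hT.2.2, fun h6 ↦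
    ((subGss_disjoint W p).1 hG.2.2).2.2.2 h6.2.2⟩, fun hT h6 ↦ ?_⟩
  exact (ClassO5.not_classO6 (W := W) (p := p) ⟨hT.1, hT.2.1, Or.inr hT.2.2⟩) h6

/-- **O7 = O7-ord ∪ O7-ss**: every pair at an odd additive prime lies in the N10 locus ((M) ∨ (G-ord),
the domain of `O7.PPart`) or in the O7-ss locus — from the five-cell partition `addv_odd_cells`. [folklore] -/
theorem O7.locus_or_ss (hp2 : p ≠ 2) (hadd : Addv W p) : N10.Locus W p ∨ O7.SS W p := by
  rcases addv_odd_cells W p hp2 hadd with hM | hG | h5 | h6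
  · exact Or.inl ⟨hp2, hadd, Or.inl hM⟩
  · exact Or.inl ⟨hp2, hadd, Or.inr hG.2⟩
  · exact Or.inr (Or.inl h5)
  · exact Or.inr (Or.inr h6)

/-- **… and in exactly one of them**: the N10 locus misses O7-ss ((M) is disjoint from O5 and (w);
`TypeGOrd` fails on O5 (`ClassO5.not_typeGOrd`) and on O6 (`p = 3`, `ClassO6.not_typeG_three`)). [folklore] -/
theorem O7.not_ss_of_locus (hL : N10.Locus W p) : ¬ O7.SS W p := by
  obtain ⟨_, _, hMG⟩ := hL
  rintro (h5 | h6)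
  · rcases hMG with hM | hG
    · exact h5.not_subM_not_subW.1 hM
    · exact h5.not_typeGOrd hG
  · rcases hMG with hM | hG
    · exact h6.addv.2.2.1 hM
    · obtain rfl := h6.p_eq_three
      exact h6.not_typeG_three.2 hG

/-- **The O7 class locus as a disjoint union** (rank-free): `(p odd ∧ E additive at p) ↔
(E, p) ∈ O7-ord-locus ∨ O7-ss-locus` ("X3 ∪ X4 at odd `p` = (M) ∪ (G-ord) ∪ (G)∧ss ∪ (t′) ∪ (w)").
[folklore] -/
theorem O7.pair_iff_locus_or_ss : (p ≠ 2 ∧ Addv W p) ↔ N10.Locus W p ∨ O7.SS W p := by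
  constructor
  · rintro ⟨hp2, hadd⟩
    exact O7.locus_or_ss W p hp2 hadd
  · rintro (hL | h5 | h6)
    · exact ⟨hL.1, hL.2.1⟩
    · exact h5.addv
    · exact ⟨h6.addv.1, h6.addv.2.1⟩

/-- X3 ∪ X4 at an odd prime = O7-ord-locus ⊔ O7-ss-locus (class form). [folklore] -/
theorem O7.classX3_or_classX4_iff_locus_or_ss (hp2 : p ≠ 2) :
    ClassX3 W p ∨ ClassX4 W p ↔ N10.Locus W p ∨ O7.SS W p := by
  rw [classX3_or_classX4_iff_addv W p hp2]
  constructor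
  · exact fun hadd ↦ O7.locus_or_ss W p hp2 hadd
  · intro h
    exact ((O7.pair_iff_locus_or_ss W p).mpr h).2

variable {W p}

/-- O7-ss pairs are additive at an odd prime. [folklore] -/
theorem O7.SS.addv (h : O7.SS W p) : p ≠ 2 ∧ Addv W p := (O7.pair_iff_locus_or_ss W p).mpr (Or.inr h)

/-- O7-ss pairs are potentially good (`ord_p j ≥ 0`). [folklore] -/
theorem O7.SS.padicValRat_j_nonneg (h : O7.SS W p) : 0 ≤ padicValRat p W.j :=
  h.elim ClassO5.padicValRat_j_nonneg ClassO6.padicValRat_j_nonneg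

/-- O7-ss pairs are not potentially good ORDINARY (neither O5 nor O6 is). [folklore] -/
theorem O7.SS.not_typeGOrd (h : O7.SS W p) : ¬ TypeGOrd W p := by
  rcases h with h5 | h6
  · exact h5.not_typeGOrd
  · obtain rfl := h6.p_eq_three
    exact h6.not_typeG_three.2

/-- O7-ss pairs are outside the N10 locus. [folklore] -/
theorem O7.SS.not_locus (h : O7.SS W p) : ¬ N10.Locus W p := fun hL ↦ O7.not_ss_of_locus W p hL h
end Cells

/-! ## §2 The O7-ss statements in Miller's currency and the partition of the O7 class statement -/

/-- **Conjecture O7 (whole class, Miller's currency)**: for every globally minimal `E/ℚ` of analytic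
rank ONE and every odd additive prime `p` (`(E, p) ∈ X3 ∪ X4`), `ord_p #Ш(E)_an = ord_p #Ш(E)`
(`Typed.MissingPPartAt W p`). It is the rank-one restriction of `X3Sharp ∧ X4Sharp`
(`O7.pPartAll_of_x3Sharp_of_x4Sharp`) and splits as O7-ord ∧ O7-ss (`O7.pPartAll_iff`). No published
or announced theorem proves it on any cell (RESIDUAL-MAP §I O7). OPEN; nothing asserted.
[cite: Miller2011LMS, Def. 1.1] -/
@[conjecture] def O7.PPartAll : Prop :=
  ∀ (W : WeierstrassCurve ℚ) [W.IsElliptic] [W.IsGloballyMinimal] (p : ℕ) [Fact p.Prime],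
    W.analyticRank = 1 → p ≠ 2 → Addv W p → MissingPPartAt W p

/-- **Conjecture O7-ss (Miller's currency)**: `MissingPPartAt` on every analytic-rank-one pair of the
O7-ss locus (`O7.SS W p`: odd additive `p` of potentially supersingular type). RESIDUAL-MAP §I O7-ss:
NOTHING is formulated in print in either half at such a prime (no Selmer condition / measure / main
conjecture of Delbourgo type — Delbourgo 1998 p. 152; no `p`-adic Gross–Zagier — Disegni 2017 needs
potentially ordinary, Kobayashi 2013 / BKO need GOOD reduction); the one exception is the `(G) ∧ ss`
cell, see `O7.PPartGss`. = the `r = 1` restriction of cc-typer-5's `O5Sharp ∧ O6Sharp`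
(`O7.pPartSS_of_o5Sharp_of_o6Sharp`). OPEN; nothing asserted.
[cite: Delbourgo1998, p. 152 (scope remark; nothing asserted)] [cite: Miller2011LMS, Def. 1.1] -/
@[conjecture] def O7.PPartSS : Prop :=
  ∀ (W : WeierstrassCurve ℚ) [W.IsElliptic] [W.IsGloballyMinimal] (p : ℕ) [Fact p.Prime],
    W.analyticRank = 1 → O7.SS W p → MissingPPartAt W p

/-- **O7-ss on the cell `(G) ∧ ss`** (`O7.CellGss`: `E = V ⊗ χ_{p*}`, `V` good supersingular at `p`;
515 census cells, all X4 non-CM) — `MissingPPartAt` in analytic rank one. = the `r = 1` restriction of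
cc-typer-5's `O5SharpGss`. SUB-PARTITION (E2, module docstring): on the sub-class `ρ_{V,p^∞}` onto
(408 cells) the UPPER half is the theorem-shaped assembly typed by cc-typer-6 as
`QuadraticBranchOddStrictSelmerBoundAt W p` (Kobayashi 2003 Thm. 4.1, `n = 0`, odd `η`-branch) +
`StrictSelmerDominatesShaAt W p`, closing the pair with the certificates `coeff₁ L_p⁻(V,η,X) ∈ ℤ_p^×`
and `ord_p #Ш_an = 0` (her sibling consumer; no `p`-adic height); residue = the 107 non-surjective
twins (conditional form on Kobayashi's even main conjecture for `V` at `η`) ∪ rows failing a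
certificate (exact odd main conjecture + an `η`-branch leading-term formula: nothing in print).
TRANSPORT (E3): `SubGss.bsdp_iff_overC_of_bsdp_twist` (base change to `ℚ(√p*)`, Milne). OPEN;
nothing asserted. [cite: Kobayashi2003, Thm. 4.1 and §4 (p. 8) (shape of the sub-class input; nothing asserted)]
[cite: Milne1972ArithmeticAV, §1 Thm. 1] [cite: Miller2011LMS, Def. 1.1] -/
@[conjecture] def O7.PPartGss : Prop :=
  ∀ (W : WeierstrassCurve ℚ) [W.IsElliptic] [W.IsGloballyMinimal] (p : ℕ) [Fact p.Prime],
    W.analyticRank = 1 → O7.CellGss W p → MissingPPartAt W p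

/-- **O7-ss on the cell (t′)** (`O7.CellTprime`; 4 705 census cells) — `MissingPPartAt` in analytic
rank one. = the `r = 1` restriction of cc-typer-5's `O5SharpTprime` (the irreducible residue of O5:
no twist / abelian base change to a semistable situation). OPEN; nothing asserted.
[cite: Delbourgo1998, p. 152 (scope remark; nothing asserted)] [cite: Miller2011LMS, Def. 1.1] -/
@[conjecture] def O7.PPartTprime : Prop :=
  ∀ (W : WeierstrassCurve ℚ) [W.IsElliptic] [W.IsGloballyMinimal] (p : ℕ) [Fact p.Prime],
    W.analyticRank = 1 → O7.CellTprime W p → MissingPPartAt W p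

/-- **O7-ss on the wild cell (w)** (`ClassO6`, `p = 3`, `v₃(N) ∈ {3,4,5}`; 14 724 census cells) —
`MissingPPartAt` in analytic rank one. = the `r = 1` restriction of cc-typer-5's `O6Sharp`. OPEN;
nothing asserted. [cite: Miller2011LMS, Def. 1.1] -/
@[conjecture] def O7.PPartW : Prop :=
  ∀ (W : WeierstrassCurve ℚ) [W.IsElliptic] [W.IsGloballyMinimal] (p : ℕ) [Fact p.Prime],
    W.analyticRank = 1 → ClassO6 W p → MissingPPartAt W p

/-- **The O7 class statement is EXACTLY O7-ord ∧ O7-ss** (`O7.locus_or_ss` / the loci' definitions):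
no rank-one additive pair at an odd prime is lost between the two halves of RESIDUAL-MAP §I O7.
[folklore] -/
theorem O7.pPartAll_iff : O7.PPartAll ↔ O7.PPart ∧ O7.PPartSS := by
  constructor
  · intro h
    exact ⟨fun W _ _ p _ hr hL ↦ h W p hr hL.1 hL.2.1, fun W _ _ p _ hr hS ↦ h W p hr hS.addv.1 hS.addv.2⟩
  · rintro ⟨hord, hss⟩ W _ _ p _ hr hp2 hadd
    rcases O7.locus_or_ss W p hp2 hadd with hL | hS
    · exact hord W p hr hL
    · exact hss W p hr hS

/-- **O7-ss is exactly the conjunction of its three cells** (`O7.ss_iff_cells`). [folklore] -/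
theorem O7.pPartSS_iff : O7.PPartSS ↔ O7.PPartGss ∧ O7.PPartTprime ∧ O7.PPartW := by
  constructor
  · intro h
    exact ⟨fun W _ _ p _ hr hc ↦ h W p hr ((O7.ss_iff_cells W p).mpr (Or.inl hc)),
      fun W _ _ p _ hr hc ↦ h W p hr ((O7.ss_iff_cells W p).mpr (Or.inr (Or.inl hc))),
      fun W _ _ p _ hr hc ↦ h W p hr ((O7.ss_iff_cells W p).mpr (Or.inr (Or.inr hc)))⟩
  · rintro ⟨hG, hT, h6⟩ W _ _ p _ hr hS
    rcases (O7.ss_iff_cells W p).mp hS with hc | hc | hc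
    · exact hG W p hr hc
    · exact hT W p hr hc
    · exact h6 W p hr hc

/-- **The full O7 partition in one line**: O7 ⟺ O7-ord(M) ∧ O7-ord(G-ord, e = 2) ∧
O7-ord(G-ord, e ∈ {3,4,6}) ∧ O7-ss((G)∧ss) ∧ O7-ss(t′) ∧ O7-ss(w) — six cells, the kernel images of
the six `obsanat` reduction atoms of `class-closure/O7/pairs.tsv`. [folklore] -/
theorem O7.pPartAll_iff_cells :
    O7.PPartAll ↔ (O7.PPartM ∧ O7.PPartGordTwo ∧ O7.PPartGordHigher) ∧
      (O7.PPartGss ∧ O7.PPartTprime ∧ O7.PPartW) := by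
  rw [O7.pPartAll_iff, O7.pPart_iff, O7.pPartSS_iff]

/-! ### Comparison with the owners' statements (one statement, one owner) -/

/-- `O5SharpGss` (cc-typer-5, ranks `≤ 1`) restricts to `O7.PPartGss`. [folklore] -/
theorem O7.pPartGss_of_o5SharpGss (h : O5SharpGss) : O7.PPartGss := fun W _ _ p _ hr hc ↦
  h W p (by rw [hr]) hc.1 hc.2.1 hc.2.2

/-- `O5SharpTprime` (cc-typer-5, ranks `≤ 1`) restricts to `O7.PPartTprime`. [folklore] -/
theorem O7.pPartTprime_of_o5SharpTprime (h : O5SharpTprime) : O7.PPartTprime := fun W _ _ p _ hr hc ↦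
  h W p (by rw [hr]) hc.1 hc.2.1 hc.2.2

/-- `O6Sharp` (cc-typer-5, ranks `≤ 1`) restricts to `O7.PPartW`. [folklore] -/
theorem O7.pPartW_of_o6Sharp (h : O6Sharp) : O7.PPartW := fun W _ _ p _ hr hc ↦ h W p (by rw [hr]) hc

/-- **`O5Sharp ∧ O6Sharp` (ranks `≤ 1`) ⟹ O7-ss** (their rank-one rows ARE O7-ss). [folklore] -/
theorem O7.pPartSS_of_o5Sharp_of_o6Sharp (h5 : O5Sharp) (h6 : O6Sharp) : O7.PPartSS :=
  fun W _ _ p _ hr hS ↦ hS.elim (fun hc ↦ h5 W p (by rw [hr]) hc) (fun hc ↦ h6 W p (by rw [hr]) hc)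

/-- **`X3Sharp ∧ X4Sharp` (the tree's sharpened conjectures, ranks `≤ 1`, every additive type) ⟹ the
whole O7 class statement.** [folklore] -/
theorem O7.pPartAll_of_x3Sharp_of_x4Sharp (h3 : X3Sharp) (h4 : X4Sharp) : O7.PPartAll := by
  intro W _ _ p _ hr hp2 hadd
  rcases (classX3_or_classX4_iff_addv W p hp2).mpr hadd with hX | hX
  · exact h3 W p (by rw [hr]) hp2 hX
  · exact h4 W p (by rw [hr]) hX

/-- `O7.PPartAll` gives O7-ord (`O7.PPart` of `O7RankOneStatements.lean`). [folklore] -/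
theorem O7.pPart_of_pPartAll (h : O7.PPartAll) : O7.PPart := (O7.pPartAll_iff.mp h).1
/-- `O7.PPartAll` gives O7-ss. [folklore] -/
theorem O7.pPartSS_of_pPartAll (h : O7.PPartAll) : O7.PPartSS := (O7.pPartAll_iff.mp h).2

/-! ## §3 The cell `(G) ∧ ss`: structure (pointers to cc-typer-5's theorems; proved) -/

section GssCell

variable {W : WeierstrassCurve ℚ} [W.IsElliptic] [W.IsGloballyMinimal] {p : ℕ} [hp : Fact p.Prime]

/-- A `(G) ∧ ss` pair is an O5 pair. [folklore] -/
theorem O7.CellGss.classO5 (h : O7.CellGss W p) : ClassO5 W p := ⟨h.1, h.2.1, Or.inl h.2.2⟩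
/-- A `(G) ∧ ss` pair is an O7-ss pair. [folklore] -/
theorem O7.CellGss.ss (h : O7.CellGss W p) : O7.SS W p := Or.inl h.classO5

/-- **`(G) ∧ ss` is Kodaira `I₀*`** (`e = 2`): `E` is the quadratic twist by `χ_{p*}` of a curve with
GOOD SUPERSINGULAR reduction at `p` (cc-typer-5's `SubGss.subGordTwo`, every odd additive `p`).
[folklore] -/
theorem O7.CellGss.subGordTwo (h : O7.CellGss W p) : SubGordTwo W p :=
  SubGss.subGordTwo W p h.1 h.2.1 h.2.2

/-- Hence a `(G) ∧ ss` pair is in the census cell `SubSemistableTwist` (a quadratic twist at `p` is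
semistable) — although NOT in the N10 locus (the twist is supersingular). [folklore] -/
theorem O7.CellGss.subSemistableTwist (h : O7.CellGss W p) : SubSemistableTwist W p :=
  Or.inr h.subGordTwo

/-- A `(G) ∧ ss` pair is outside the N10 locus (domain of O7-ord). [folklore] -/
theorem O7.CellGss.not_locus (h : O7.CellGss W p) : ¬ N10.Locus W p := h.ss.not_locus

/-- **`(G) ∧ ss` lies in X4**: `E[p]` is IRREDUCIBLE (the cell is empty on the Eisenstein class X3 —
cc-typer-5's `not_subGss_of_classX3`: a rational `p`-isogeny is incompatible with good supersingular
reduction of the twist). Census: 515/515 X4. [folklore] -/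
theorem O7.CellGss.classX4 (h : O7.CellGss W p) : ClassX4 W p := by
  by_cases hi : Irr W p
  · exact ⟨h.1, h.2.1, hi⟩
  · exact absurd h.2.2 (not_subGss_of_classX3 W p h.1 ⟨hi, h.2.1⟩)

/-- On X4 the cell `(G) ∧ ss` is `(G)` minus the (G-ord) class (`subGss_iff_of_classX4`). [folklore] -/
theorem O7.cellGss_iff_of_classX4 (hX : ClassX4 W p) :
    O7.CellGss W p ↔ SubGord W p ∧ ¬ ClassX4Gord W p := by
  rw [← subGss_iff_of_classX4 W p hX]
  exact ⟨fun h ↦ h.2.2, fun h ↦ ⟨hX.1, hX.2.1, h⟩⟩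

/-- **On the `(G) ∧ ss` cell the O7 statement transports to `K = ℚ(√p*)`** (E3 of the lane; cc-typer-5's
Milne transport, instantiated in rank one): granted `BSD_p` of the good supersingular twist `Wd` (its
own cell: JSW 2017 / X6-type), GZK and modularity, `MissingPPartAt W p ↔` the `p`-part of BSD for `E_K`
(`AdditivePotMult.MissingPPartOverCAt (W.baseChange K) p`). The comparison statement a twist link of
`class-closure/O7/relations*.tsv` needs on this cell is therefore `BSDp Wd p` + this iff; `p` is
RAMIFIED in `K` (B. D. Kim 2013's control needs `p` unramified — the printed gap).
[cite: Milne1972ArithmeticAV, §1 Thm. 1] [cite: Miller2011LMS, §1 and Def. 1.1] -/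
theorem O7.CellGss.missingPPartAt_iff_overC_of_bsdp_twist (_h : O7.CellGss W p)
    (K : Type) [Field K] [NumberField K] (Wd : WeierstrassCurve ℚ) [Wd.IsElliptic] [Wd.IsGloballyMinimal]
    (hGZK : rank_eq_analyticRank_of_analyticRank_le_one) (hmod : hasEntireLFunction_rat)
    (hMilneC : Milne1972.bsdQuotient_baseChange_quadratic_anyModel)
    (hr : W.analyticRank = 1) (h2 : Module.finrank ℚ K = 2)
    (hWd : ∃ C : VariableChange ℚ, C • W.quadraticTwist (NumberField.discr K : ℚ) = Wd)
    (hrd : Wd.analyticRank ≤ 1) (hd : BSDp Wd p) :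
    MissingPPartAt W p ↔ AdditivePotMult.MissingPPartOverCAt (W.baseChange K) p := by
  have hr1 : W.analyticRank ≤ 1 := by rw [hr]
  rw [← SubGss.bsdp_iff_overC_of_bsdp_twist W p K Wd hGZK hmod hMilneC hr1 h2 hWd hrd hd]
  haveI : Finite W.sha := (hGZK W hr1).2
  exact ⟨bsdp_of_missingPPartAt W p hGZK hr1, missingPPartAt_of_bsdp W p⟩

end GssCell

end Summit.BirchSwinnertonDyer.Rank1Residual.Additive

end
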